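import Mathlib.MeasureTheory.Measure.Lebesgue.Integral
import Literature.NumberTheory.Transcendental.SemialgebraicVolumeComputable
import Literature.NumberTheory.Transcendental.KZCalculus
import HarnessLib

/-!
# Integral representations with bounded data are computable reals

Companion to `SemialgebraicVolumeComputable.lean` (volumes of bounded `ℚ`-semialgebraic sets are
computable reals). Yoshinaga's reduction step [Yoshinaga 2008, arXiv:0805.0349, Lemma 24 (i)] turns
a period into integrals `∫_{K_α} H(z) dz₁ ⋯ dz_ℓ` of a *bounded* (indeed `C^∞`) semialgebraic
function `H` over a *bounded* semialgebraic set `K_α`, and then (displayed equation (eq. for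
`D_α`)) into the volume of the bounded semialgebraic set
`D_α = {(x, t) | x ∈ K_α, 0 ≤ t ≤ H_α(x)}`. This file proves that last passage and its consequence
inside the tree's calculus:

* `KZ.IntegralRep.volume_subgraph_eq` — for a `ℚ`-semialgebraic function `f` on a
  measurable `σ ⊆ ℝⁿ`, integrable on `σ`, the strict subgraph
  `{(x, t) | x ∈ σ, 0 < t < f x} ⊆ ℝⁿ⁺¹` has volume `∫_σ max(f, 0)` (Fubini / Mathlib's
  `volume_regionBetween_eq_integral`, transported along `ℝⁿ⁺¹ ≃ ℝ × ℝⁿ`);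
* `KZ.IntegralRep.isComputableReal_value_of_bounded` — **an integral representation with
  bounded domain and bounded integrand represents a computable real**: its value is
  `vol(E₊) − vol(E₋)` for the bounded `ℚ`-semialgebraic subgraphs `E₊`, `E₋` of `f` and `−f`
  (semialgebraic by graph elimination, i.e. Tarski–Seidenberg), and such volumes are computable
  (`SemialgVolume.isComputableReal_volume_sub`);
* `isComputableReal_setIntegral_of_bounded` — the same for KZ-literal data `∫_σ p/q`;
* `isComputableReal_of_isRealPeriod_of_boundedRepresentation`,
  `isComputableComplex_of_isPeriod_of_boundedRepresentation` — Yoshinaga's computability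
  statements (the named facts of `PeriodConjecture.lean`) follow from the existence, for every real
  period, of a representation with bounded domain and bounded integrand (the output of
  Yoshinaga's Lemma 24 (i), via Belkale–Brosnan and Hironaka's rectilinearization; equivalently
  Viu-Sos' compact reduction), taken as an explicit hypothesis and NOT vendored as a named fact.

## References

* M. Yoshinaga, *Periods and elementary real numbers*, arXiv:0805.0349 (2008), §3.2, Lemma 24.
* J. Viu-Sos, *A semi-canonical reduction for periods of Kontsevich–Zagier*, Int. J. Number Theory
  17 (2021), Thm. 1.1, Cor. 2.3.
* M. Kontsevich, D. Zagier, *Periods* (2001), §1.1 ("the integral of any real-valued function is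
  equal to the area under its graph").
-/

noncomputable section

open MeasureTheory Set Metric Filter Topology
open scoped ENNReal
open Literature.ModelTheory.ExponentialFields

namespace Literature.NumberTheory.Transcendental

namespace KZ

namespace IntegralRep

variable {n : ℕ}

/-- **Volume of the strict subgraph.** For `f` with measurable extension by zero off a measurable
`σ ⊆ ℝⁿ` and integrable on `σ`, the set `{(x, t) ∈ ℝⁿ⁺¹ | x ∈ σ, 0 < t < f x}` has volume
`∫_σ max(f, 0)` ("the integral of a function is the area under its graph", Kontsevich–Zagier 2001,
§1.1; Fubini). [cite: KontsevichZagier2001, §1.1] -/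
theorem volume_subgraph_eq {σ : Set (Fin n → ℝ)} (hσ : MeasurableSet σ) {f : (Fin n → ℝ) → ℝ}
    (hfm : Measurable (σ.indicator f)) (hf : IntegrableOn f σ) :
    volume {v : Fin (n + 1) → ℝ | Fin.init v ∈ σ ∧ 0 < v (Fin.last n) ∧ v (Fin.last n) < f (Fin.init v)}
      = ENNReal.ofReal (∫ x in σ, max (f x) 0) := by
  set F : (Fin n → ℝ) → ℝ := σ.indicator f with hF
  set G : (Fin n → ℝ) → ℝ := fun x => max (F x) 0 with hG
  have hGm : Measurable G := hfm.max measurable_const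
  have hGf : ∀ x ∈ σ, G x = max (f x) 0 := fun x hx => by
    simp [hG, hF, Set.indicator_of_mem hx]
  have hG_int : IntegrableOn G σ := by
    refine IntegrableOn.congr_fun (hf.pos_part) (fun x hx => (hGf x hx).symm) hσ
  set R : Set ((Fin n → ℝ) × ℝ) := regionBetween (fun _ => 0) G σ with hR
  have hRm : MeasurableSet R := measurableSet_regionBetween measurable_const hGm hσ
  have hvolR : (volume : Measure (Fin n → ℝ)).prod (volume : Measure ℝ) R =
      ENNReal.ofReal (∫ x in σ, max (f x) 0) := by
    rw [hR, volume_regionBetween_eq_integral (integrableOn_zero) hG_int hσ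
      (fun x _ => le_max_right _ _)]
    congr 1
    refine setIntegral_congr_fun hσ fun x hx => ?_
    simp [hGf x hx]
  -- transport along `ℝⁿ⁺¹ ≃ ℝ × ℝⁿ`
  set e : (Fin (n + 1) → ℝ) ≃ᵐ ℝ × (Fin n → ℝ) :=
    MeasurableEquiv.piFinSuccAbove (fun _ => ℝ) (Fin.last n) with he_def
  have he : MeasurePreserving e volume volume :=
    volume_preserving_piFinSuccAbove (fun _ => ℝ) (Fin.last n)
  have he_apply : ∀ v : Fin (n + 1) → ℝ, e v = (v (Fin.last n), Fin.init v) := fun v => by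
    refine Prod.ext ?_ ?_
    · simp [he_def, MeasurableEquiv.piFinSuccAbove]
    · funext j
      simp [he_def, MeasurableEquiv.piFinSuccAbove, Fin.init]
  have hset : {v : Fin (n + 1) → ℝ | Fin.init v ∈ σ ∧ 0 < v (Fin.last n) ∧
      v (Fin.last n) < f (Fin.init v)} = e ⁻¹' (Prod.swap ⁻¹' R) := by
    ext v
    simp only [mem_setOf_eq, mem_preimage, he_apply, Prod.swap_prod_mk, hR, regionBetween, mem_Ioo]
    constructor
    · rintro ⟨hσv, h0, hlt⟩
      refine ⟨hσv, h0, ?_⟩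
      rw [hGf _ hσv]
      exact lt_max_of_lt_left hlt
    · rintro ⟨hσv, h0, hlt⟩
      refine ⟨hσv, h0, ?_⟩
      rw [hGf _ hσv, lt_max_iff] at hlt
      rcases hlt with h | h
      · exact h
      · exact absurd h0 (not_lt.2 h.le)
  rw [hset, he.measure_preimage ((measurable_swap hRm).nullMeasurableSet), Measure.volume_eq_prod,
    ← Measure.map_apply measurable_swap hRm, Measure.prod_swap]
  exact hvolR

open Literature.Computability.Complexity in
/-- **Integral representations with bounded data are computable.** If `r = (σ, f)` has bounded
domain and integrand bounded on the domain, then `r.value = ∫_σ f` is a computable real: it equals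
`vol(E₊) − vol(E₋)` for the strict subgraphs `E₊ = {(x,t) | x ∈ σ, 0 < t < f x}` and
`E₋ = {(x,t) | x ∈ σ, 0 < t < −f x}`, which are bounded and `ℚ`-semialgebraic (graph elimination,
Tarski–Seidenberg), and volumes of bounded `ℚ`-semialgebraic sets are computable
(`SemialgVolume.isComputableReal_volume`). This is the passage `∫_{K_α} H = vol(D_α)` of
Yoshinaga 2008, proof of Lemma 24 (i), followed by the effective approximation of §§3.3–3.6.
[cite: Yoshinaga2008, Lemma 24 (i) and §3.6] -/
theorem isComputableReal_value_of_bounded (r : IntegralRep n) (hb : Bornology.IsBounded r.domain)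
    (hM : ∃ M : ℝ, ∀ x ∈ r.domain, |r.integrand x| ≤ M) : IsComputableReal r.value := by
  obtain ⟨M, hM⟩ := hM
  have hTS : Literature.ModelTheory.ExponentialFields.tarski_seidenberg_real (k := ℚ) :=
    Literature.ModelTheory.ExponentialFields.tarski_seidenberg_real_holds
  have hσm : MeasurableSet r.domain := IntegralRep.measurableSet_domain_holds r
  -- the two subgraphs
  set E : ((Fin n → ℝ) → ℝ) → Set (Fin (n + 1) → ℝ) := fun g =>
    {v | Fin.init v ∈ r.domain ∧ 0 < v (Fin.last n) ∧ v (Fin.last n) < g (Fin.init v)} with hE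
  have hT : IsSemialgebraic ℚ {u : Fin (n + 2) → ℝ |
      0 < u (Fin.castSucc (Fin.last n)) ∧ u (Fin.castSucc (Fin.last n)) < u (Fin.last (n + 1))} := by
    have h1 := isSemialgebraic_setOf_eval_pos (k := ℚ) (R := ℝ)
      (MvPolynomial.X (Fin.castSucc (Fin.last n)) : MvPolynomial (Fin (n + 2)) ℚ)
    have h2 := isSemialgebraic_setOf_eval_lt (k := ℚ) (R := ℝ)
      (MvPolynomial.X (Fin.castSucc (Fin.last n)) : MvPolynomial (Fin (n + 2)) ℚ)
      (MvPolynomial.X (Fin.last (n + 1)))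
    convert h1.inter h2 using 1
    ext u
    simp [Set.mem_inter_iff]
  have hEsa : ∀ g, IsSemialgebraicFunOn ℚ r.domain g → IsSemialgebraic ℚ (E g) := by
    intro g hg
    convert hg.isSemialgebraic_setOf_snoc_mem hTS hT using 1
    ext v
    simp [hE]
  have hEb : ∀ g, (∀ x ∈ r.domain, |g x| ≤ M) → Bornology.IsBounded (E g) := by
    intro g hgM
    obtain ⟨ρ, hρ⟩ := hb.subset_closedBall 0
    rw [isBounded_iff_forall_norm_le]
    refine ⟨max ρ M, fun v hv => ?_⟩
    obtain ⟨hv1, hv2, hv3⟩ := hv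
    have hinit : ‖Fin.init v‖ ≤ ρ := by simpa using hρ hv1
    rw [pi_norm_le_iff_of_nonneg ((norm_nonneg _).trans hinit |>.trans (le_max_left _ _))]
    intro i
    refine Fin.lastCases ?_ (fun j => ?_) i
    · rw [Real.norm_eq_abs, abs_of_pos hv2]
      exact ((hv3.le.trans (le_abs_self _)).trans (hgM _ hv1)).trans (le_max_right _ _)
    · have : ‖Fin.init v j‖ ≤ ‖Fin.init v‖ := norm_le_pi_norm _ j
      exact (this.trans hinit).trans (le_max_left _ _)
  have hEvol : ∀ g, IsSemialgebraicFunOn ℚ r.domain g → IntegrableOn g r.domain →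
      (volume (E g)).toReal = ∫ x in r.domain, max (g x) 0 := by
    intro g hg hgi
    rw [hE]
    dsimp only
    rw [volume_subgraph_eq hσm (hg.measurable_indicator_of_tarskiSeidenberg hTS hσm) hgi,
      ENNReal.toReal_ofReal]
    exact setIntegral_nonneg hσm fun x _ => le_max_right _ _
  have hf := r.isSemialgebraicFunOn_integrand
  have hfi := r.integrableOn
  have hval : r.value = (volume (E r.integrand)).toReal - (volume (E (-r.integrand))).toReal := by
    rw [hEvol _ hf hfi, hEvol _ hf.neg hfi.neg]
    simp only [Pi.neg_apply]
    rw [← integral_sub hfi.pos_part hfi.neg_part, value]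
    refine integral_congr_ae (Eventually.of_forall fun x => ?_)
    exact (max_zero_sub_max_neg_zero_eq_self (r.integrand x)).symm
  rw [hval]
  exact SemialgVolume.isComputableReal_volume_sub (hEsa _ hf) (hEsa _ hf.neg) (hEb _ hM)
    (hEb _ fun x hx => by simpa using hM x hx)

end IntegralRep

end KZ

open Literature.Computability.Complexity in
/-- **KZ-literal data, bounded case.** An absolutely convergent integral `∫_σ p/q` (`p, q` rational
polynomials, `q ≠ 0` on the `ℚ`-semialgebraic `σ`) with `σ` bounded and `p/q` bounded on `σ` is a
computable real. [cite: Yoshinaga2008, Lemma 24 (i) and §3.6] -/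
theorem isComputableReal_setIntegral_of_bounded {n : ℕ} {σ : Set (Fin n → ℝ)}
    {p q : MvPolynomial (Fin n) ℚ} (hσ : IsSemialgebraic ℚ σ)
    (hq : ∀ y ∈ σ, MvPolynomial.aeval y q ≠ 0)
    (hint : IntegrableOn (fun y => MvPolynomial.aeval y p / MvPolynomial.aeval y q) σ)
    (hb : Bornology.IsBounded σ)
    (hM : ∃ M : ℝ, ∀ y ∈ σ, |MvPolynomial.aeval y p / MvPolynomial.aeval y q| ≤ M) :
    IsComputableReal (∫ y in σ, MvPolynomial.aeval y p / MvPolynomial.aeval y q) :=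
  (KZ.IntegralRep.ofRational σ p q hσ hq hint).isComputableReal_value_of_bounded hb hM

open Literature.Computability.Complexity in
/-- **Real periods are computable, granted bounded representations** (Yoshinaga 2008, Thm. 18
with Lemma 24 (i): every period is a combination of integrals `∫_{K_α} H` of bounded semialgebraic
functions over bounded semialgebraic sets — obtained there from the Belkale–Brosnan description of
periods and Hironaka's rectilinearization). If every real period is the value of an integral
representation with bounded domain and bounded integrand, then every real period is a computable
real. The hypothesis (resolution of singularities for the naive `IsRealPeriod`) is explicit and is
not vendored as a named fact. [cite: Yoshinaga2008, Thm. 18 with Lemma 24 (i)] -/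
theorem isComputableReal_of_isRealPeriod_of_boundedRepresentation
    (H : ∀ x : ℝ, IsRealPeriod x → ∃ (n : ℕ) (r : KZ.IntegralRep n), Bornology.IsBounded r.domain ∧
      (∃ M : ℝ, ∀ y ∈ r.domain, |r.integrand y| ≤ M) ∧ r.value = x) :
    isComputableReal_of_isRealPeriod := by
  intro x hx
  obtain ⟨n, r, hb, hM, rfl⟩ := H x hx
  exact r.isComputableReal_value_of_bounded hb hM

/-- **Periods are computable complex numbers, granted bounded representations** (complex form of
the previous theorem). [cite: Yoshinaga2008, Thm. 18 complex form] -/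
theorem isComputableComplex_of_isPeriod_of_boundedRepresentation
    (H : ∀ x : ℝ, IsRealPeriod x → ∃ (n : ℕ) (r : KZ.IntegralRep n), Bornology.IsBounded r.domain ∧
      (∃ M : ℝ, ∀ y ∈ r.domain, |r.integrand y| ≤ M) ∧ r.value = x) :
    isComputableComplex_of_isPeriod := by
  intro z hz
  exact ⟨isComputableReal_of_isRealPeriod_of_boundedRepresentation H hz.1,
    isComputableReal_of_isRealPeriod_of_boundedRepresentation H hz.2⟩

end Literature.NumberTheory.Transcendental
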